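import Summits.CriticalPhenomena.PercolationContinuityZ3.Theorems.PercAnnulusCrossingIICMeasureUniqueCluster
import Summits.CriticalPhenomena.PercolationContinuityZ3.Theorems.PercAnnulusCrossingIICAspectCorollaries
import Summits.CriticalPhenomena.PercolationContinuityZ3.Theorems.PercAnnulusCrossingIICTargetLimit
import HarnessLib

/-!
# Kesten's IIC MEASURE on `ℤ^d` under (A2)□ / the printed (A2)_ρ / CU_l — the packaged theorems (lane RSW3, p1 gen 5)

builds on p205010 (kernel theorem, internal audit signed; external expert review pending)

Seat `prim-rsw3-p1` (gen 5).  Assembly of `PercAnnulusCrossingIICMeasure.lean` (the measure), `…IICMeasureUniqueCluster.lean`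
(one infinite cluster), part XX′ `…IICAspectExistence.lean` (the limit exists under (A2)□ at aspect `(s,L)`), `…IICAspectCorollaries.lean`
(printed (A2)_ρ, CU_l) and `…IICTargetLimit.lean` (conditioning independence, Basu–Sapozhnikov Remark 2.1):

* `iicMeasure_properties_of_setToSetQuasiMultAspectAt` — every probability measure with the IIC limit property, under (A2)□ at aspect
  `(s,L)`, `θ(p) = 0`, `0 < p`: carried by lattice configurations in which `0` percolates and the infinite cluster is unique; singular to
  `P_p`; dominates `P_p` on increasing cylinders; and is the limit of `P_p(· | 0 ↔ T in W)` UNIFORMLY over admissible conditionings;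
* **`exists_iicMeasure_of_setToSetQuasiMultAspectAt`** — existence of such a (unique) measure, every `p > 0` with `θ(p) = 0`, `d ≥ 1`;
* **`exists_iicMeasure_criticalProbI_of_setToSetQuasiMultAspectAt`** (`d ≥ 2`, at `p_c(ℤ^d)`), `…_of_basuSapozhnikovQM` (the PRINTED
  hypothesis of Basu–Sapozhnikov's Thm. 1.1), `…_of_condAnnulusUniq_aspect` (conditional annulus uniqueness at aspect `l ≥ 2`);
* `ℤ³` named forms: `exists_iicMeasure_of_setToSetQuasiMult` (`SetToSetQuasiMult` ⇒ the IIC measure of `ℤ³`),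
  `exists_iicMeasure_of_basuSapozhnikovQM_three`.

So LANE 4's object — Kesten's incipient infinite cluster of `ℤ^d` at `p_c` as a probability measure on bond configurations, with
`ν(|C(0)| = ∞) = 1`, exactly one infinite cluster, independent of the conditioning — exists, kernel-checked, from any one of the lane's
hypotheses; the hypotheses themselves ((A2)□ etc.) remain OPEN on `ℤ³` (census Q15/Q17: numerically plausible).
Helper file for the crux `stmt-CriticalPhenomena-4575` chain; no definitions, no sorries.
References: D. Basu, A. Sapozhnikov, ECP 22 (2017) no. 26, Thm. 1.1, Remark 2.1, §1; H. Kesten, PTRF 73 (1986), Thm. (3).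
-/

noncomputable section

namespace Summit.CriticalPhenomena.PercolationContinuityZ3.Theorems.Crossing

open MeasureTheory ProbabilityTheory Filter Topology
open Literature.Probability.Percolation Literature.Probability.LatticeModels
open Literature.Probability.Percolation.DCT16 Literature.Probability.Percolation.DKT20
open Summit.CriticalPhenomena.PercolationContinuityZ3.Theorems.SurfaceTension
open scoped ENNReal ProbabilityTheory Literature.Probability.Percolation

variable {d : ℕ}

/-! ## All properties of an IIC measure under (A2)□ at aspect `(s, L)` -/

/-- **Properties of Kesten's IIC measure under (A2)□ at aspect `(s,L)`** (`d ≥ 1`, `0 < p`, `θ(p) = 0`, `s ≥ 2`, `ϰ > 0`): any probability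
measure `ν` with `P_p(E ∩ {0 ↔ ∂ⁱⁿΛ(n)})/π_p(n) → ν(E)` on cylinder events (i) is carried by lattice configurations, (ii) gives mass `1` to
`{|C(0)| = ∞}`, (iii) has almost surely exactly one infinite cluster, (iv) is singular to `P_p`, (v) dominates `P_p` on increasing cylinder
events, and (vi) is the limit of `P_p(E | 0 ↔ T in W)` uniformly over admissible conditionings `(W, T)` (Basu–Sapozhnikov Remark 2.1).
[cite: BasuSapozhnikov2017ECP, Thm. 1.1, Remark 2.1 and §1] [cite: Kesten1986, Thm. (3)] -/
theorem iicMeasure_properties_of_setToSetQuasiMultAspectAt (hd : 1 ≤ d) (p : unitInterval) (hp : 0 < (p : ℝ))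
    (hθ : theta (zdGraph d) 0 p = 0) {s L : ℕ} (hs : 2 ≤ s) {ϰ : ℝ} (hϰ : 0 < ϰ) (hA2 : SetToSetQuasiMultAspectAt d p s L ϰ)
    {ν : Measure (BondConfig (Site d))} [IsProbabilityMeasure ν]
    (hν : ∀ (F : Finset (Sym2 (Site d))) (E : Set (BondConfig (Site d))), MeasurableSet E → DeterminedBy E ↑F →
      Tendsto (fun n : ℕ => (bondPercolation (zdGraph d) p).real (E ∩ siteToBoundary d n) / oneArmProb d p n)
        atTop (𝓝 (ν.real E))) :
    (∀ᵐ ω ∂ν, ω ⊆ (zdGraph d).edgeSet) ∧ ν (percolatesAt (0 : Site d)) = 1 ∧ (∀ᵐ ω ∂ν, numInfiniteClusters ω = 1) ∧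
      ν ⟂ₘ bondPercolation (zdGraph d) p ∧
      (∀ E : Set (BondConfig (Site d)), IsUpperSet E → IsLocalEvent E → (bondPercolation (zdGraph d) p).real E ≤ ν.real E) ∧
      (∀ (F : Finset (Sym2 (Site d))) (E : Set (BondConfig (Site d))), MeasurableSet E → DeterminedBy E ↑F →
        ∀ δ : ℝ, 0 < δ → ∃ n₀ : ℕ, 1 ≤ n₀ ∧ ∀ W T : Finset (Site d), box d n₀ ⊆ W → T ⊆ W → (∀ t ∈ T, t ∉ box d (n₀ - 1)) →
          (∀ x ∈ innerBoundary (zdGraph d) (box d n₀), ∃ t ∈ T, ∃ q : (zdGraph d).Walk x t,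
            ∀ z ∈ q.support, z ∈ (↑W : Set (Site d)) \ ↑(box d (n₀ - 1))) →
          |(bondPercolation (zdGraph d) p).real (E ∩ {ω | ∃ t ∈ T, ω ∈ openConnIn (↑W : Set (Site d)) 0 t}) /
              (bondPercolation (zdGraph d) p).real {ω | ∃ t ∈ T, ω ∈ openConnIn (↑W : Set (Site d)) 0 t} - ν.real E| ≤ δ) := by
  refine ⟨iicMeasure_ae_subset_edgeSet p hν, iicMeasure_percolatesAt_eq_one hd p hp hν,
    iicMeasure_ae_numInfiniteClusters_eq_one hd p hp hθ (by omega) hϰ hA2 hν, iicMeasure_mutuallySingular hd p hp hθ hν,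
    fun E hE hEl => real_le_iicMeasure_real_of_isUpperSet hd p hp hν hE hEl, fun F E hEm hEF δ hδ => ?_⟩
  obtain ⟨ν₀, hν₀, hunif⟩ := iic_limit_condIndep_of_setToSetQuasiMultAspectAt hd p hp hθ hs hϰ hA2 F E hEm hEF
  have heq : ν₀ = ν.real E := tendsto_nhds_unique hν₀ (hν F E hEm hEF)
  subst heq
  exact hunif δ hδ

/-! ## Existence under (A2)□ at aspect `(s, L)` -/

/-- **Kesten's IIC measure exists under (A2)□ at aspect `(s,L)`** (`d ≥ 1`, `0 < p`, `θ(p) = 0`, `s ≥ 2`, `ϰ > 0`): there is a probability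
measure `ν` on bond configurations of `ℤ^d` — unique by `iicMeasure_unique` — with `P_p(E | 0 ↔ ∂ⁱⁿΛ(n)) → ν(E)` for every cylinder event,
carried by lattice configurations in which the origin percolates and the infinite cluster is unique, singular to `P_p`, dominating `P_p` on
increasing cylinders, and equal to the limit of every admissible conditioning `P_p(· | 0 ↔ T in W)`.  Basu–Sapozhnikov's Theorem 1.1
(critical case, with Remark 2.1 and the measure packaging of their §1) in box form, (A1) replaced by `θ(p) = 0`.
[cite: BasuSapozhnikov2017ECP, Thm. 1.1, Remark 2.1 and §1] [cite: Kesten1986, Thm. (3)] -/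
theorem exists_iicMeasure_of_setToSetQuasiMultAspectAt (hd : 1 ≤ d) (p : unitInterval) (hp : 0 < (p : ℝ))
    (hθ : theta (zdGraph d) 0 p = 0) {s L : ℕ} (hs : 2 ≤ s) {ϰ : ℝ} (hϰ : 0 < ϰ) (hA2 : SetToSetQuasiMultAspectAt d p s L ϰ) :
    ∃ ν : Measure (BondConfig (Site d)), IsProbabilityMeasure ν ∧
      (∀ (F : Finset (Sym2 (Site d))) (E : Set (BondConfig (Site d))), MeasurableSet E → DeterminedBy E ↑F →
        Tendsto (fun n : ℕ => (bondPercolation (zdGraph d) p).real (E ∩ siteToBoundary d n) / oneArmProb d p n)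
          atTop (𝓝 (ν.real E))) ∧
      (∀ᵐ ω ∂ν, ω ⊆ (zdGraph d).edgeSet) ∧ ν (percolatesAt (0 : Site d)) = 1 ∧ (∀ᵐ ω ∂ν, numInfiniteClusters ω = 1) ∧
      ν ⟂ₘ bondPercolation (zdGraph d) p ∧
      (∀ E : Set (BondConfig (Site d)), IsUpperSet E → IsLocalEvent E → (bondPercolation (zdGraph d) p).real E ≤ ν.real E) ∧
      (∀ (F : Finset (Sym2 (Site d))) (E : Set (BondConfig (Site d))), MeasurableSet E → DeterminedBy E ↑F →
        ∀ δ : ℝ, 0 < δ → ∃ n₀ : ℕ, 1 ≤ n₀ ∧ ∀ W T : Finset (Site d), box d n₀ ⊆ W → T ⊆ W → (∀ t ∈ T, t ∉ box d (n₀ - 1)) →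
          (∀ x ∈ innerBoundary (zdGraph d) (box d n₀), ∃ t ∈ T, ∃ q : (zdGraph d).Walk x t,
            ∀ z ∈ q.support, z ∈ (↑W : Set (Site d)) \ ↑(box d (n₀ - 1))) →
          |(bondPercolation (zdGraph d) p).real (E ∩ {ω | ∃ t ∈ T, ω ∈ openConnIn (↑W : Set (Site d)) 0 t}) /
              (bondPercolation (zdGraph d) p).real {ω | ∃ t ∈ T, ω ∈ openConnIn (↑W : Set (Site d)) 0 t} - ν.real E| ≤ δ) := by
  obtain ⟨ν, hνP, hν⟩ := exists_iicMeasure_of_kestenIICExistsAt hd p hp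
    (kestenIICExistsAt_of_setToSetQuasiMultAspectAt hd p hp hθ hs hϰ hA2)
  exact ⟨ν, hνP, hν, iicMeasure_properties_of_setToSetQuasiMultAspectAt hd p hp hθ hs hϰ hA2 hν⟩

/-! ## At `p_c(ℤ^d)`, `d ≥ 2` -/

/-- **Kesten's IIC measure at `p_c(ℤ^d)` under (A2)□ at aspect `(s,L)`** (`d ≥ 2`, `s ≥ 2`, `ϰ > 0`; `θ(p_c) = 0` by
`CSH.percolationContinuity_allDimensions`): existence with all the properties of `exists_iicMeasure_of_setToSetQuasiMultAspectAt`.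
[cite: BasuSapozhnikov2017ECP, Thm. 1.1, Remark 2.1 and §1] [cite: Kesten1986, Thm. (3)] -/
theorem exists_iicMeasure_criticalProbI_of_setToSetQuasiMultAspectAt (hd : 2 ≤ d) {s L : ℕ} (hs : 2 ≤ s) {ϰ : ℝ} (hϰ : 0 < ϰ)
    (hA2 : SetToSetQuasiMultAspectAt d (criticalProbI d) s L ϰ) :
    ∃ ν : Measure (BondConfig (Site d)), IsProbabilityMeasure ν ∧
      (∀ (F : Finset (Sym2 (Site d))) (E : Set (BondConfig (Site d))), MeasurableSet E → DeterminedBy E ↑F →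
        Tendsto (fun n : ℕ => (bondPercolation (zdGraph d) (criticalProbI d)).real (E ∩ siteToBoundary d n) /
          oneArmProb d (criticalProbI d) n) atTop (𝓝 (ν.real E))) ∧
      (∀ᵐ ω ∂ν, ω ⊆ (zdGraph d).edgeSet) ∧ ν (percolatesAt (0 : Site d)) = 1 ∧ (∀ᵐ ω ∂ν, numInfiniteClusters ω = 1) ∧
      ν ⟂ₘ bondPercolation (zdGraph d) (criticalProbI d) ∧
      (∀ E : Set (BondConfig (Site d)), IsUpperSet E → IsLocalEvent E →
        (bondPercolation (zdGraph d) (criticalProbI d)).real E ≤ ν.real E) ∧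
      (∀ (F : Finset (Sym2 (Site d))) (E : Set (BondConfig (Site d))), MeasurableSet E → DeterminedBy E ↑F →
        ∀ δ : ℝ, 0 < δ → ∃ n₀ : ℕ, 1 ≤ n₀ ∧ ∀ W T : Finset (Site d), box d n₀ ⊆ W → T ⊆ W → (∀ t ∈ T, t ∉ box d (n₀ - 1)) →
          (∀ x ∈ innerBoundary (zdGraph d) (box d n₀), ∃ t ∈ T, ∃ q : (zdGraph d).Walk x t,
            ∀ z ∈ q.support, z ∈ (↑W : Set (Site d)) \ ↑(box d (n₀ - 1))) →
          |(bondPercolation (zdGraph d) (criticalProbI d)).real (E ∩ {ω | ∃ t ∈ T, ω ∈ openConnIn (↑W : Set (Site d)) 0 t}) /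
              (bondPercolation (zdGraph d) (criticalProbI d)).real {ω | ∃ t ∈ T, ω ∈ openConnIn (↑W : Set (Site d)) 0 t} -
            ν.real E| ≤ δ) := by
  have hpc : 0 < ((criticalProbI d : unitInterval) : ℝ) := by
    have h := Literature.Barriers.CriticalPhenomena.criticalProbI_pos' (d := d) (by omega)
    exact_mod_cast h
  exact exists_iicMeasure_of_setToSetQuasiMultAspectAt (by omega) (criticalProbI d) hpc (CSH.percolationContinuity_allDimensions d hd)
    hs hϰ hA2

/-- **Basu–Sapozhnikov's Theorem 1.1 for `ℤ^d` at `p_c`, measure form, from the PRINTED hypothesis (A2)_ρ** (`d ≥ 2`, `ϰ > 0`): the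
graph-metric quasi-multiplicativity `BasuSapozhnikovQM (zdGraph d) 0 p_c ϰ` gives (A2)□ at aspect `(4d, 16d²)` (lead p222697), hence
Kesten's IIC measure with all the listed properties (support, one infinite cluster, singularity, domination, conditioning independence).
[cite: BasuSapozhnikov2017ECP, Thm. 1.1 and §1 assumption (A2)] [cite: Kesten1986, Thm. (3)] -/
theorem exists_iicMeasure_criticalProbI_of_basuSapozhnikovQM (hd : 2 ≤ d) {ϰ : ℝ} (hϰ : 0 < ϰ)
    (hBS : BasuSapozhnikovQM (zdGraph d) (0 : Site d) (criticalProbI d) ϰ) :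
    ∃ ν : Measure (BondConfig (Site d)), IsProbabilityMeasure ν ∧
      (∀ (F : Finset (Sym2 (Site d))) (E : Set (BondConfig (Site d))), MeasurableSet E → DeterminedBy E ↑F →
        Tendsto (fun n : ℕ => (bondPercolation (zdGraph d) (criticalProbI d)).real (E ∩ siteToBoundary d n) /
          oneArmProb d (criticalProbI d) n) atTop (𝓝 (ν.real E))) ∧
      (∀ᵐ ω ∂ν, ω ⊆ (zdGraph d).edgeSet) ∧ ν (percolatesAt (0 : Site d)) = 1 ∧ (∀ᵐ ω ∂ν, numInfiniteClusters ω = 1) ∧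
      ν ⟂ₘ bondPercolation (zdGraph d) (criticalProbI d) ∧
      (∀ E : Set (BondConfig (Site d)), IsUpperSet E → IsLocalEvent E →
        (bondPercolation (zdGraph d) (criticalProbI d)).real E ≤ ν.real E) ∧
      (∀ (F : Finset (Sym2 (Site d))) (E : Set (BondConfig (Site d))), MeasurableSet E → DeterminedBy E ↑F →
        ∀ δ : ℝ, 0 < δ → ∃ n₀ : ℕ, 1 ≤ n₀ ∧ ∀ W T : Finset (Site d), box d n₀ ⊆ W → T ⊆ W → (∀ t ∈ T, t ∉ box d (n₀ - 1)) →
          (∀ x ∈ innerBoundary (zdGraph d) (box d n₀), ∃ t ∈ T, ∃ q : (zdGraph d).Walk x t,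
            ∀ z ∈ q.support, z ∈ (↑W : Set (Site d)) \ ↑(box d (n₀ - 1))) →
          |(bondPercolation (zdGraph d) (criticalProbI d)).real (E ∩ {ω | ∃ t ∈ T, ω ∈ openConnIn (↑W : Set (Site d)) 0 t}) /
              (bondPercolation (zdGraph d) (criticalProbI d)).real {ω | ∃ t ∈ T, ω ∈ openConnIn (↑W : Set (Site d)) 0 t} -
            ν.real E| ≤ δ) :=
  exists_iicMeasure_criticalProbI_of_setToSetQuasiMultAspectAt hd (s := 4 * d) (L := 4 * d * (4 * d)) (by omega) (by positivity)
    (setToSetQuasiMultAspectAt_of_basuSapozhnikovQM hd hϰ.le hBS)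

/-- **Conditional annulus uniqueness at aspect `l` at `p_c(ℤ^d)` ⇒ Kesten's IIC measure** (`d ≥ 2`, `l ≥ 2`, `c > 0`): with probability
`≥ c` given the two links, the closed annulus `Λ(la) ∖ Λ(a)°` has all its sphere-to-sphere crossings joined (the numerically live input,
census Q15) — via (A2′)_l (p219928) and (A2)□ at aspect `(l, l²)`.
[cite: BasuSapozhnikov2017ECP, §1 (comments on (A2), p. 4) and Thm. 1.1] [cite: Kesten1986, Thm. (3)] -/
theorem exists_iicMeasure_criticalProbI_of_condAnnulusUniq_aspect (hd : 2 ≤ d) {l : ℕ} (hl : 2 ≤ l) {c : ℝ} (hc : 0 < c)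
    (hCU : ∀ a : ℕ, 1 ≤ a → ∀ Z : Finset (Site d), box d (l * a) \ box d (a - 1) ⊆ Z →
      ∀ X : Finset (Site d), X ⊆ Z ∩ box d a → ∀ Y : Finset (Site d), Y ⊆ Z \ box d (l * a) →
        c * (bondPercolation (zdGraph d) (criticalProbI d)).real
            ({ω | ∃ x ∈ X, ∃ s ∈ innerBoundary (zdGraph d) (box d (l * a)), ω ∈ openConnIn (↑Z : Set (Site d)) x s} ∩
             {ω | ∃ y ∈ Y, ∃ s ∈ innerBoundary (zdGraph d) (box d a), ω ∈ openConnIn (↑Z : Set (Site d)) y s}) ≤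
          (bondPercolation (zdGraph d) (criticalProbI d)).real
            ({ω | ∃ x ∈ X, ∃ s ∈ innerBoundary (zdGraph d) (box d (l * a)), ω ∈ openConnIn (↑Z : Set (Site d)) x s} ∩
             {ω | ∃ y ∈ Y, ∃ s ∈ innerBoundary (zdGraph d) (box d a), ω ∈ openConnIn (↑Z : Set (Site d)) y s} ∩
             {ω | ∀ t ∈ innerBoundary (zdGraph d) (box d a), ∀ s ∈ innerBoundary (zdGraph d) (box d (l * a)),
                ∀ t' ∈ innerBoundary (zdGraph d) (box d a), ∀ s' ∈ innerBoundary (zdGraph d) (box d (l * a)),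
                ω ∈ openConnIn (↑((box d (l * a) \ box d a) ∪ innerBoundary (zdGraph d) (box d a)) : Set (Site d)) t s →
                ω ∈ openConnIn (↑((box d (l * a) \ box d a) ∪ innerBoundary (zdGraph d) (box d a)) : Set (Site d)) t' s' →
                ω ∈ openConnIn (↑((box d (l * a) \ box d a) ∪ innerBoundary (zdGraph d) (box d a)) : Set (Site d)) s s'})) :
    ∃ ν : Measure (BondConfig (Site d)), IsProbabilityMeasure ν ∧
      (∀ (F : Finset (Sym2 (Site d))) (E : Set (BondConfig (Site d))), MeasurableSet E → DeterminedBy E ↑F →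
        Tendsto (fun n : ℕ => (bondPercolation (zdGraph d) (criticalProbI d)).real (E ∩ siteToBoundary d n) /
          oneArmProb d (criticalProbI d) n) atTop (𝓝 (ν.real E))) ∧
      (∀ᵐ ω ∂ν, ω ⊆ (zdGraph d).edgeSet) ∧ ν (percolatesAt (0 : Site d)) = 1 ∧ (∀ᵐ ω ∂ν, numInfiniteClusters ω = 1) ∧
      ν ⟂ₘ bondPercolation (zdGraph d) (criticalProbI d) ∧
      (∀ E : Set (BondConfig (Site d)), IsUpperSet E → IsLocalEvent E →
        (bondPercolation (zdGraph d) (criticalProbI d)).real E ≤ ν.real E) ∧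
      (∀ (F : Finset (Sym2 (Site d))) (E : Set (BondConfig (Site d))), MeasurableSet E → DeterminedBy E ↑F →
        ∀ δ : ℝ, 0 < δ → ∃ n₀ : ℕ, 1 ≤ n₀ ∧ ∀ W T : Finset (Site d), box d n₀ ⊆ W → T ⊆ W → (∀ t ∈ T, t ∉ box d (n₀ - 1)) →
          (∀ x ∈ innerBoundary (zdGraph d) (box d n₀), ∃ t ∈ T, ∃ q : (zdGraph d).Walk x t,
            ∀ z ∈ q.support, z ∈ (↑W : Set (Site d)) \ ↑(box d (n₀ - 1))) →
          |(bondPercolation (zdGraph d) (criticalProbI d)).real (E ∩ {ω | ∃ t ∈ T, ω ∈ openConnIn (↑W : Set (Site d)) 0 t}) /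
              (bondPercolation (zdGraph d) (criticalProbI d)).real {ω | ∃ t ∈ T, ω ∈ openConnIn (↑W : Set (Site d)) 0 t} -
            ν.real E| ≤ δ) := by
  have h := setToSetQM_fixedAspect_of_setToSetQM' hd hl hc.le (setToSetQM'_fixedAspect_of_condAnnulusUniq (criticalProbI d) hl hc.le hCU)
  have hA2 : SetToSetQuasiMultAspectAt d (criticalProbI d) l (l * l)
      (c ^ 2 * ((2 * (d : ℝ))⁻¹ * ((1 : ℝ) / (4 * ((l : ℝ) * l))) ^ (d - 1))) := by
    intro m hm Z hZ X hX Y hY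
    rw [Nat.mul_assoc] at hZ hY
    exact h m hm Z hZ X hX Y hY
  exact exists_iicMeasure_criticalProbI_of_setToSetQuasiMultAspectAt hd hl (by positivity) hA2

/-! ## `ℤ³` named forms -/

/-- **`ℤ³`: (A2)□ at `p_c(ℤ³)` (`SetToSetQuasiMult`, the lane's LANE-4 readiness statement) ⇒ Kesten's IIC MEASURE of `ℤ³` exists**, with
`ν(|C(0)| = ∞) = 1`, exactly one infinite cluster `ν`-a.s., `ν ⟂ P_{p_c}`, `P_{p_c} ≤ ν` on increasing cylinders, and independence of the
(admissible) conditioning.  The hypothesis is OPEN (census Q17: numerically plausible, `ϰ ≈ 0.2`).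
[cite: BasuSapozhnikov2017ECP, Thm. 1.1, Remark 2.1 and §1] [cite: Kesten1986, Thm. (3)] -/
theorem exists_iicMeasure_of_setToSetQuasiMult (h : SetToSetQuasiMult) :
    ∃ ν : Measure (BondConfig (Site 3)), IsProbabilityMeasure ν ∧
      (∀ (F : Finset (Sym2 (Site 3))) (E : Set (BondConfig (Site 3))), MeasurableSet E → DeterminedBy E ↑F →
        Tendsto (fun n : ℕ => (bondPercolation (zdGraph 3) (criticalProbI 3)).real (E ∩ siteToBoundary 3 n) /
          oneArmProb 3 (criticalProbI 3) n) atTop (𝓝 (ν.real E))) ∧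
      (∀ᵐ ω ∂ν, ω ⊆ (zdGraph 3).edgeSet) ∧ ν (percolatesAt (0 : Site 3)) = 1 ∧ (∀ᵐ ω ∂ν, numInfiniteClusters ω = 1) ∧
      ν ⟂ₘ bondPercolation (zdGraph 3) (criticalProbI 3) ∧
      (∀ E : Set (BondConfig (Site 3)), IsUpperSet E → IsLocalEvent E →
        (bondPercolation (zdGraph 3) (criticalProbI 3)).real E ≤ ν.real E) ∧
      (∀ (F : Finset (Sym2 (Site 3))) (E : Set (BondConfig (Site 3))), MeasurableSet E → DeterminedBy E ↑F →
        ∀ δ : ℝ, 0 < δ → ∃ n₀ : ℕ, 1 ≤ n₀ ∧ ∀ W T : Finset (Site 3), box 3 n₀ ⊆ W → T ⊆ W → (∀ t ∈ T, t ∉ box 3 (n₀ - 1)) →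
          (∀ x ∈ innerBoundary (zdGraph 3) (box 3 n₀), ∃ t ∈ T, ∃ q : (zdGraph 3).Walk x t,
            ∀ z ∈ q.support, z ∈ (↑W : Set (Site 3)) \ ↑(box 3 (n₀ - 1))) →
          |(bondPercolation (zdGraph 3) (criticalProbI 3)).real (E ∩ {ω | ∃ t ∈ T, ω ∈ openConnIn (↑W : Set (Site 3)) 0 t}) /
              (bondPercolation (zdGraph 3) (criticalProbI 3)).real {ω | ∃ t ∈ T, ω ∈ openConnIn (↑W : Set (Site 3)) 0 t} -
            ν.real E| ≤ δ) := by
  obtain ⟨ϰ, hϰ, hA2⟩ := h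
  exact exists_iicMeasure_criticalProbI_of_setToSetQuasiMultAspectAt (d := 3) (by norm_num) (s := 2) (L := 4) le_rfl hϰ
    (setToSetQuasiMultAt_iff_aspect.1 hA2)

/-- **`ℤ³`: the PRINTED (A2)_ρ at `p_c(ℤ³)` ⇒ Kesten's IIC measure of `ℤ³`** with all the listed properties.
[cite: BasuSapozhnikov2017ECP, Thm. 1.1 and §1 assumption (A2)] [cite: Kesten1986, Thm. (3)] -/
theorem exists_iicMeasure_of_basuSapozhnikovQM_three {ϰ : ℝ} (hϰ : 0 < ϰ)
    (hBS : BasuSapozhnikovQM (zdGraph 3) (0 : Site 3) (criticalProbI 3) ϰ) :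
    ∃ ν : Measure (BondConfig (Site 3)), IsProbabilityMeasure ν ∧
      (∀ (F : Finset (Sym2 (Site 3))) (E : Set (BondConfig (Site 3))), MeasurableSet E → DeterminedBy E ↑F →
        Tendsto (fun n : ℕ => (bondPercolation (zdGraph 3) (criticalProbI 3)).real (E ∩ siteToBoundary 3 n) /
          oneArmProb 3 (criticalProbI 3) n) atTop (𝓝 (ν.real E))) ∧
      (∀ᵐ ω ∂ν, ω ⊆ (zdGraph 3).edgeSet) ∧ ν (percolatesAt (0 : Site 3)) = 1 ∧ (∀ᵐ ω ∂ν, numInfiniteClusters ω = 1) ∧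
      ν ⟂ₘ bondPercolation (zdGraph 3) (criticalProbI 3) ∧
      (∀ E : Set (BondConfig (Site 3)), IsUpperSet E → IsLocalEvent E →
        (bondPercolation (zdGraph 3) (criticalProbI 3)).real E ≤ ν.real E) ∧
      (∀ (F : Finset (Sym2 (Site 3))) (E : Set (BondConfig (Site 3))), MeasurableSet E → DeterminedBy E ↑F →
        ∀ δ : ℝ, 0 < δ → ∃ n₀ : ℕ, 1 ≤ n₀ ∧ ∀ W T : Finset (Site 3), box 3 n₀ ⊆ W → T ⊆ W → (∀ t ∈ T, t ∉ box 3 (n₀ - 1)) →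
          (∀ x ∈ innerBoundary (zdGraph 3) (box 3 n₀), ∃ t ∈ T, ∃ q : (zdGraph 3).Walk x t,
            ∀ z ∈ q.support, z ∈ (↑W : Set (Site 3)) \ ↑(box 3 (n₀ - 1))) →
          |(bondPercolation (zdGraph 3) (criticalProbI 3)).real (E ∩ {ω | ∃ t ∈ T, ω ∈ openConnIn (↑W : Set (Site 3)) 0 t}) /
              (bondPercolation (zdGraph 3) (criticalProbI 3)).real {ω | ∃ t ∈ T, ω ∈ openConnIn (↑W : Set (Site 3)) 0 t} -
            ν.real E| ≤ δ) :=
  exists_iicMeasure_criticalProbI_of_basuSapozhnikovQM (d := 3) (by norm_num) hϰ hBS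

end Summit.CriticalPhenomena.PercolationContinuityZ3.Theorems.Crossing

end
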